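import Summits.QuantumFields.Statement
import Literature.StrongHypotheses.QuantumFields
import HarnessLib
import HarnessLib.Audit.TribunalTags

/-!
# Summit `QuantumFields` — bridges of the Strong-Hypothesis Library (D-0034, skeleton)

Summit-side BRIDGE file for the registry `Literature/StrongHypotheses/QuantumFields.lean`. For every `H`
tagged there with `@[strong_hypothesis "QuantumFields.YangMills"]` / `"QuantumFields.QCD"]` this file
would carry ONE bridge `@[summit_bridge …]` concluding the ROOT problem decls `_root_.YangMills`
(`Summits/QuantumFields/YangMills/Statement.lean`) resp. `_root_.QCD` (`Summits/QuantumFields/QCD/Statement.lean`;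
NOT `Literature.MathematicalPhysics.QuantumFieldTheory.QCD`, which is registered hypothesis no. 7).

## Bridges: NONE (0 landed, 0 printed) — and why

All seven registered decls are COGNATE READINGS of the same printed problems (Jaffe–Witten 2000 §4 for
`YangMills`; §§1, 5 for `QCD`) in other vocabularies — single-plaquette-field OS measures on `𝒮'(ℝ⁴)`
(`ClayYangMillsEuclideanGap`, `ClayYangMillsEuclidean`, `ClayYangMillsEuclideanAlong`), Wightman data
(`ClayYangMills`), infinite-volume lattice plaquette correlations (`LatticeMassGapAllCouplings`,
`ChatterjeeMassGapProblem` = Chatterjee 2019 Problem 5.1), and the first Euclidean QCD rendering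
(`Literature.MathematicalPhysics.QuantumFieldTheory.QCD`, `∀ N_f ∈ [2,6]`, ∃ masses) — whereas the summit's
problems ask for species-indexed joint OS data `OSData ι 4` tied to a weak-coupling lattice scheme with a
FULL-SPECTRUM gap in the continuum AND uniformly on the lattices (`HasLatticeMassGap`), for every compact
simple `G` resp. for every positive mass tuple of one chiral-at-zero regularisation. No text proves that
any of the cognate forms implies these (Jaffe–Witten fix the axioms only as "at least as strong as
[Streater–Wightman, Osterwalder–Schrader]"; Chatterjee §5: "none of the above has been proved", and his
Problems 5.1/5.2 are lattice statements with no continuum OS data; `YangMillsEuclidean.lean`'s own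
docstring: "Neither form is known to imply the other … the Clay text does not distinguish them"), and the
formal contents are incomparable (fewer observables and no lattice-uniform gap on the cognate side; no
area law and no `ξ(β)`-asymptotics on the summit side). Writing `def HImpliesYangMills : Prop := H →
_root_.YangMills` as a PRINTED bridge would therefore cite a proof that does not exist — CONVENTIONS §4
forbids it. The registry entries are still probed by the tribunal and reported `bridge: none`
(informational): a crux implied by a cognate Clay reading is the Clay problem in costume.

Follow-ups a literature-prover could turn into LANDED partial bridges (none is `H → P`):
* `_root_.YangMills → (∀ G …, ∃ …)`-fragments: the summit's `OSData`/`IsYangMillsFor` should yield the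
  single-field OS measure of `ClayYangMillsEuclideanGap` for the curvature species (direction `P → H`,
  useful to the tribunal's sandwich but not a `summit_bridge`); blocked today by the two vocabularies
  (`OSData` species fields vs `FieldConfig`-valued laws) having no comparison lemma in the tree.
* `LatticeMassGapAllCouplings ↔ ChatterjeeMassGapProblem` (two transcriptions of one problem; needs the
  `LGConfig`/`ZdGaugeConfig` and `infiniteVolumeLimitPoints`/`IsInfiniteVolumeLimit` dictionaries).

No new mathematics; no `sorry`, no axiom.
-/

namespace Summit.QuantumFields.StrongHypotheses

end Summit.QuantumFields.StrongHypotheses
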